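import Literature.MathematicalPhysics.QuantumFieldTheory.Balaban1983to89.B2Eq350TowerVolume
import Literature.MathematicalPhysics.QuantumFieldTheory.Balaban1983to89.B2Eq244Cutoff

/-!
# `Balaban1983to89.B2Eq28RegionsCollars` — [Balaban1982Higgs2] (2.8) p. 558 ITERATED AT SITE LEVEL on the concrete (Higgs)₂,₃ tori:
the regions `Λ₂ ⊂ Λ₁ ⊂ Λ₀ ⊂ Λ₋₁` are `r(ε)`-COLLARED, so a point within `3r(ε)` (minus rounding) of `Λ₂` lies in `Λ₋₁`; in the
block-label currency of the next step this is EXACTLY the region hypothesis `nbhd` of Lemma 2.3 on the carrier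
(`B2Lemma23HiggsLattice.lemma23_higgsLattice`, `B2Prop31MinimizerFamilyK.RMultiMK.nbhd`) for the typer's CONSTRUCTED regions
`B2Eq243RegionsTower.towerRegion`, with the cut-off radius of GAPS.md G-B2-12 (c) `ρ_k = 3r(L^{k−1}ε)/L − 2M − 2`

statement-level skeleton of published theorems with citation tags; proofs where landed; nothing here is a claim about the Yang–Mills mass gap

CITATION HEADER.  T. Bałaban, *(Higgs)₂,₃ quantum fields in a finite volume. II. An upper bound*, Commun. Math. Phys. **86** (1982)
555–594 [Balaban1982Higgs2] (PDF held `paper:balaban1982-cmp86-higgs23-ii`, journal page = PDF page + 554; pp. 558 [PDF 4], 566 [PDF 12],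
570–571 [PDF 16–17] on the ×2 renders `run/shared/lean/pub/pub-balaban/b2b-balaban-ref1/pages/1982-cmp86-higgs23-II/…-p004/p012/p016/p017-x2.png`);
part I [Balaban1982Higgs1] (1.3) p. 604, (1.17)–(1.20) pp. 606–607.  Cell `lit-balaban` (HOME `run/shared/lean/pub/lit-balaban/`), Phase-2
proof seat **p23** gen 13 (unit `lit-balaban-p23-g13`; TAKING line HOME/STATUS.md 2026-08-22T04:49:42Z; owner r02's note 04:32:54Z *"`RMultiMK.nbhd`
is dischargeable from `B2Eq243RegionsTower` with the radius (c)"*).  SKELETON rows **B2.Eq2.7** ((2.7)–(2.8), owner r02 / reader r14; row of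
record r14's abstract `B2LargeField.lambdaCompl`, concrete instance the typer's `B2Eq28RegionsConcrete`/`B2Eq255RegionsWindow`/
`B2Eq243RegionsTower`), **B2.Eq2.44**, **B2.Lem2.3** — CELLS ONLY, no head claims.  USED BY NAME, NOTHING RESTATED: the typer's
`regionRel`/`towerRegion`/`near`/`prime` and their separations `sep_regionRel` ((2.8) at site level), `B2Eq350TowerVolume.sitesPerDir_eq_L_mul_succ`,
`B1Ineq234Concrete.val_blockOf_all`, r14's `tdist_comm`/`tdist_triangle_real`, b2b's `B2.rFn`.

WHY THIS FILE (GAPS.md **G-B2-12**, OWNER ADJUDICATION r02 g11 2026-08-22T04:40Z adopting r14 g13's READER NOTE).  Lemma 2.3 p. 571 is proved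
*"Using Proposition 2.2 and the restrictions (2.55)"*, and (2.55) p. 570 holds *"for x ∈ Λ₋₁^{(k−1)′}, b ⊂ Λ₋₁^{(k−1)′}"*; the first term of
(2.61) sums `A(y′) − A(y)` over `y′ ∈ supp ζ^{(k)}(x, ·)`, `x ∈ Bᵏ(Λ₂^{(k−1)′})`, so the proof needs `supp ζ^{(k)}(x, ·) ⊂ Λ₋₁^{(k−1)′}` there.
With the (2.44) support radius `r(Lᵏε) − 2M` this inclusion FAILS at early steps for `L ≥ 4` (the three (2.8)-collars between `Λ₂^{(k−1)′}` and
`(Λ₋₁^{(k−1)′})ᶜ` measure `≈ 3r(L^{k−1}ε)/L` in `T₁^{(k)}`-units); the cell's ruling: *"REAL as printed, print ∕ underspecified (radius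
bookkeeping), CONSTANTS-ONLY REPAIR (c): step-k cut-off radius ρ_k := 3r(L^{k−1}ε)/L − 2M − 2 (plateau ½ρ_k), so that supp ζ^{(k)}(x,·) ⊂
Λ₋₁^{(k−1)′} with connecting paths for x ∈ Bᵏ(Λ₂^{(k−1)′})"*.  In the tree the inclusion is the HYPOTHESIS `nbhd` of r14's
`lemma23_higgsLattice` and the FIELD `nbhd` of p23's `RMultiM`/`RMultiMK`; THIS FILE PROVES IT for the constructed regions at the radius (c)
(`nbhd_radC`), from (2.8) alone — the geometry of *"Λ_{i+1}ᶜ is the sum of all large blocks of T₁ with distances from the set Λ_iᶜ less or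
equal r(ε)"* (p. 558) iterated along lattice geodesics.

WHAT IS PRINTED.  (2.8) p. 558 (quoted above); p. 558: *"Of course all the fields are small on the set Λ₀ and on the neighbourhood of Λ₀ of the
additional thickness r(ε) also. … Let us denote by Λ^{(*,′)}_{−1} the set of the points (the bonds, the blocks) in T₁ distant from Λ₀ less than
r(ε)."*; (I.1.3) p. 604: `|x − y| = max_μ min{|x_μ − y_μ|, 2L_μ − |x_μ − y_μ|}`; (I.1.17)/(I.1.20) pp. 606–607 (blocks `B(y)`, labels `y = ⌊x/L⌋`).

DICTIONARY.  `Λ_i^{(j)}` ↦ `regionRel W bad r i` / `towerRegion bad r j i` (Finsets of `HiggsLattice.Site P j`, distances (I.1.3) `Site.tdist` in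
lattice units of `T^{(j)}`, radius `r ↤ r(Lʲε)`); `Λ₋₁^{(j)}` (its POINT part) ↦ `near (Λ₀^{(j)}) r` = `{y : |x − y| < r for some x ∈ Λ₀^{(j)}}`
(typer, gen 8); `Λ′` ↦ p15's `prime` (coarse sites whose block lies in `Λ`; for `Λ₋₁` this is CONTAINED IN the printed *"blocks distant from Λ₀
less than r"*, so assuming (2.55) on `prime (near Λ₀ r)` assumes LESS than print — the faithful direction); `x_k` ↦ `blockIter k x`.

WHAT THIS MODULE PROVES (kernel-checked, 0 `sorry`, standard axioms; THEOREMS ONLY — no definition, no `Prop`-valued fact).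
 §1 `exists_tdist_split` — GEODESIC SPLITTING for (I.1.3): for sites `x, y` of a torus `T^{(k)}` and `n : ℕ` there is `z` with `|x − z| ≤ n` and
    `|z − y| ≤ |x − y| − n` (move each coordinate `min(n, dist)` steps towards `y` the short way round).
 §2 `tdist_le_mul_tdist_blockOf_add` — FINE BELOW COARSE under the block map `T^{(l)} → T^{(l+1)}` (`l < K`): `|x − y| ≤ L·|x₁ − y₁| + (L − 1)`
    (the converse direction of the typer's `B2Eq350TowerVolume.mul_tdist_blockOf_le`).
 §3 the collars of (2.8) at site level: `mem_regionRel_of_tdist_le` (`x ∈ Λ_{i+1}`, `|x − y| ≤ n ≤ r ⇒ y ∈ Λ_i`), **`mem_regionRel_of_tdist_le_mul`**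
    (`x ∈ Λ_{i+m+1}`, `|x − y| ≤ (m+1)·n ⇒ y ∈ Λ_i`, induction along §1), **`mem_near_regionRel_of_tdist_le`** (`x ∈ Λ_{i+2}`, `|x − y| ≤ 3n`, `n < r`
    ⇒ `y ∈ near (Λ_i) r`: two collars and the *"additional thickness r(ε)"*); tower forms `mem_towerRegion_of_tdist_le_mul`, `mem_near_towerRegion_of_tdist_le`.
 §4 the block-label form: **`mem_prime_near_of_tdist_blockOf_le`** (`x₁ ∈ (Λ_{i+2})′`, `|x₁ − y′| ≤ ρ + 1`, `L(ρ + 2) − 1 ≤ 3n`, `n < r` ⇒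
    `y′ ∈ (near Λ_i r)′`) and **`nbhd_towerRegion`** = the `nbhd` hypothesis of `lemma23_higgsLattice`/`RMultiMK` for `L2 = (Λ₂^{(l)})′`,
    `L1 = (near Λ₀^{(l)} r_l)′ ⊆ Λ₋₁^{(l)′}`, any radius `ρ` with `L(ρ + 2) − 1 ≤ 3n`, `n < r_l`.
 §5 the ruled radius (c) `ρ_k = 3r(L^{k−1}ε)/L − 2M − 2` (`r(s) = B2.rFn R r s`, written out): `radC_geom` (`L(ρ_k + 2) − 1 ≤ 3(⌈r(L^{k−1}ε)⌉ − 1)`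
    for `M, L ≥ 1`) and **`nbhd_radC`**: for every torus, every `bad`, every `k = l + 1 ≤ K` with `r(Lˡε) > 0`: `x_k ∈ (Λ₂^{(l)})′`,
    `|x_k − y′| ≤ ρ_k + 1 ⇒ y′ ∈ (near Λ₀^{(l)} r(Lˡε))′`; and (§4) `prime_mono`, `prime_towerRegion_two_subset` (`(Λ₂^{(l)})′ ⊆ (near Λ₀^{(l)} r)′`),
    `prime_lam_subset` (`(Λ₅^{(l)})′ ⊆ (Λ₂^{(l)})′`) — the `L2_sub`/`lam_sub` shapes.
HONEST SCOPE.  (i) Pure lattice geometry downstream of the typer's construction; which points are bad is data.  (ii) `Λ₋₁′` is read as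
`prime (near Λ₀ r)` (blocks ENTIRELY within `< r` of `Λ₀`) ⊆ the printed block set; (2.55) assumed there is weaker than print's.  (iii) The
radius (c) is the cell's READING (G-B2-12), not a printed number; any `ρ` with `L(ρ + 2) ≤ 3⌈r(L^{k−1}ε)⌉ − 2` works (§4), (c) is one
(`radC_geom`, using only `ML ≥ 1`).  (iv) Levels `k ≤ K` (the block map is `L`-to-`1` there).  (v) No field, no measure, no estimate; no row head
changes (owner r02).  Nothing here is summit progress.
-/

noncomputable section

open Finset Real
open scoped BigOperators

namespace Literature.MathematicalPhysics.QuantumFieldTheory.Balaban1983to89.B2Eq28RegionsCollars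

open Literature.MathematicalPhysics.QuantumFieldTheory.Balaban1983to89.HiggsLattice
open Literature.MathematicalPhysics.QuantumFieldTheory.Balaban1983to89.HiggsAveraging
open Literature.MathematicalPhysics.QuantumFieldTheory.Balaban1983to89.B2Eq28RegionsConcrete (near mem_near subset_near near_mono)
open Literature.MathematicalPhysics.QuantumFieldTheory.Balaban1983to89.B2Eq255RegionsWindow (regionRel sep_regionRel regionRel_antitone)
open Literature.MathematicalPhysics.QuantumFieldTheory.Balaban1983to89.B2Eq243RegionsTower
  (towerRegion window towerRegion_eq towerOf towerOf_lam_of_lt towerRegion_antitone)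
open Literature.MathematicalPhysics.QuantumFieldTheory.Balaban1983to89.B2Eq350TowerVolume (sitesPerDir_eq_L_mul_succ)
open Literature.MathematicalPhysics.QuantumFieldTheory.Balaban1983to89.B2Eq324NestedRegions (prime mem_prime blockIter_succ_eq)
open Literature.MathematicalPhysics.QuantumFieldTheory.Balaban1983to89.B1Ineq234Concrete (val_blockOf_all)
open Literature.MathematicalPhysics.QuantumFieldTheory.Balaban1983to89.B1Ineq234LevelZero (tdist_comm tdist_triangle_real)

variable {P : HiggsLattice.Params} {k : ℕ}

/-! ## §1 Geodesic splitting for the torus distance (I.1.3) -/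

/-- One coordinate: in `ℤ/Nℤ`, from `a` one can move `≤ n` steps (the short way round towards `b`) to a residue `c` with
`dist(c, b) ≤ dist(a, b) − n`. [folklore] [cite: Balaban1982Higgs1, (1.3) p.604] -/
private theorem zmod_exists_split {N : ℕ} [NeZero N] (a b : ZMod N) (n : ℕ) :
    ∃ c : ZMod N, min (a - c).val (c - a).val ≤ n ∧
      min (c - b).val (b - c).val ≤ min (a - b).val (b - a).val - n := by
  rcases le_total (b - a).val (a - b).val with h | h
  · -- `b` is ahead of `a`: move forward by `m = min n (b − a).val`
    set m : ℕ := min n (b - a).val with hm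
    have hmN : m < N := lt_of_le_of_lt (min_le_right _ _) (ZMod.val_lt _)
    have hmval : ((m : ℕ) : ZMod N).val = m := by rw [ZMod.val_natCast, Nat.mod_eq_of_lt hmN]
    refine ⟨a + m, ?_, ?_⟩
    · have h1 : (a + (m : ZMod N) - a).val = m := by rw [add_sub_cancel_left, hmval]
      calc min (a - (a + (m : ZMod N))).val (a + (m : ZMod N) - a).val ≤ (a + (m : ZMod N) - a).val := min_le_right _ _
        _ = m := h1
        _ ≤ n := min_le_left _ _
    · have hle : ((m : ℕ) : ZMod N).val ≤ (b - a).val := by rw [hmval]; exact min_le_right _ _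
      have h2 : (b - (a + (m : ZMod N))).val = (b - a).val - m := by
        rw [← sub_sub, ZMod.val_sub hle, hmval]
      rw [min_eq_right h]
      calc min (a + (m : ZMod N) - b).val (b - (a + (m : ZMod N))).val ≤ (b - (a + (m : ZMod N))).val := min_le_right _ _
        _ = (b - a).val - m := h2
        _ ≤ (b - a).val - n := by rw [hm]; omega
  · -- `b` is behind `a`: move backward by `m = min n (a − b).val`
    set m : ℕ := min n (a - b).val with hm
    have hmN : m < N := lt_of_le_of_lt (min_le_right _ _) (ZMod.val_lt _)
    have hmval : ((m : ℕ) : ZMod N).val = m := by rw [ZMod.val_natCast, Nat.mod_eq_of_lt hmN]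
    refine ⟨a - m, ?_, ?_⟩
    · have h1 : (a - (a - (m : ZMod N))).val = m := by rw [sub_sub_cancel, hmval]
      calc min (a - (a - (m : ZMod N))).val (a - (m : ZMod N) - a).val ≤ (a - (a - (m : ZMod N))).val := min_le_left _ _
        _ = m := h1
        _ ≤ n := min_le_left _ _
    · have hle : ((m : ℕ) : ZMod N).val ≤ (a - b).val := by rw [hmval]; exact min_le_right _ _
      have h2 : (a - (m : ZMod N) - b).val = (a - b).val - m := by
        rw [sub_right_comm, ZMod.val_sub hle, hmval]
      rw [min_eq_left h]
      calc min (a - (m : ZMod N) - b).val (b - (a - (m : ZMod N))).val ≤ (a - (m : ZMod N) - b).val := min_le_left _ _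
        _ = (a - b).val - m := h2
        _ ≤ (a - b).val - n := by rw [hm]; omega

/-- **GEODESIC SPLITTING for the torus distance (I.1.3)**: for sites `x, y ∈ T^{(k)}` and `n : ℕ` there is a site `z` with `|x − z| ≤ n` and
`|z − y| ≤ |x − y| − n` (lattice units; each coordinate moved `min(n, ·)` steps towards `y` the short way round). [cite: Balaban1982Higgs1, (1.3) p.604] -/
theorem exists_tdist_split (x y : HiggsLattice.Site P k) (n : ℕ) :
    ∃ z : HiggsLattice.Site P k, HiggsLattice.Site.tdist x z ≤ n ∧
      HiggsLattice.Site.tdist z y ≤ HiggsLattice.Site.tdist x y - n := by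
  choose c hc using fun μ : Fin P.d => zmod_exists_split (x μ) (y μ) n
  refine ⟨fun μ => c μ, ?_, ?_⟩
  · unfold HiggsLattice.Site.tdist
    exact Finset.sup_le fun μ _ => (hc μ).1
  · unfold HiggsLattice.Site.tdist
    refine Finset.sup_le fun μ _ => (hc μ).2.trans ?_
    exact Nat.sub_le_sub_right
      (Finset.le_sup (f := fun ν : Fin P.d => min (x ν - y ν).val (y ν - x ν).val) (Finset.mem_univ μ)) n

/-! ## §2 Fine below coarse under the block map `T^{(l)} → T^{(l+1)}` -/

/-- `(b − a) mod n = n − ((a − b) mod n)` for `a ≠ b` in `ℤ/nℤ`. [folklore] [cite: Balaban1982Higgs1, (1.3) p.604] -/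
private theorem val_sub_rev {n : ℕ} [NeZero n] {a b : ZMod n} (h : a ≠ b) : (b - a).val = n - (a - b).val := by
  rw [← neg_sub, ZMod.neg_val, if_neg (sub_ne_zero.mpr h)]

/-- One coordinate: for `n = L·m` and labels `A = ⌊a/L⌋`, `B = ⌊b/L⌋`, `dist_{ℤ/n}(a, b) ≤ L·dist_{ℤ/m}(A, B) + (L − 1)`. [folklore]
[cite: Balaban1982Higgs1, (1.20) p.607] -/
private theorem coord_fine_le {n m L : ℕ} [NeZero n] [NeZero m] (hn : n = L * m) (hL : 0 < L)
    (a b : ZMod n) (A B : ZMod m) (hA : A.val = a.val / L) (hB : B.val = b.val / L) :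
    min (a - b).val (b - a).val ≤ L * min (A - B).val (B - A).val + (L - 1) := by
  wlog hba : b.val ≤ a.val generalizing a b A B
  · have h := this b a B A hB hA (not_le.mp hba).le
    rwa [min_comm (b - a).val, min_comm (B - A).val] at h
  have hBA : B.val ≤ A.val := by rw [hA, hB]; exact Nat.div_le_div_right hba
  have hA1 : L * A.val ≤ a.val := by rw [hA, mul_comm]; exact Nat.div_mul_le_self _ _
  have hA2 : a.val < L * A.val + L := by rw [hA, mul_comm]; exact Nat.lt_div_mul_add hL
  have hB1 : L * B.val ≤ b.val := by rw [hB, mul_comm]; exact Nat.div_mul_le_self _ _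
  have hB2 : b.val < L * B.val + L := by rw [hB, mul_comm]; exact Nat.lt_div_mul_add hL
  have hsubA : (A - B).val = A.val - B.val := ZMod.val_sub hBA
  have hsuba : (a - b).val = a.val - b.val := ZMod.val_sub hba
  have hmval : A.val < m := ZMod.val_lt A
  by_cases hAB : A = B
  · subst hAB
    have h0 : (A - A).val = 0 := by rw [sub_self, ZMod.val_zero]
    rw [h0, min_self, mul_zero, zero_add]
    calc min (a - b).val (b - a).val ≤ (a - b).val := min_le_left _ _
      _ ≤ L - 1 := by rw [hsuba]; omega
  · have hab : a ≠ b := by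
      rintro rfl
      exact hAB (ZMod.val_injective _ (by rw [hA, hB]))
    rw [val_sub_rev hAB, val_sub_rev hab, hsubA, hsuba]
    have h1 : a.val - b.val ≤ L * (A.val - B.val) + (L - 1) := by
      rw [mul_tsub]; omega
    have h2 : n - (a.val - b.val) ≤ L * (m - (A.val - B.val)) + (L - 1) := by
      rw [mul_tsub, mul_tsub, ← hn]; omega
    rcases le_total (A.val - B.val) (m - (A.val - B.val)) with h | h
    · rw [min_eq_left h]; exact (min_le_left _ _).trans h1
    · rw [min_eq_right h]; exact (min_le_right _ _).trans h2

/-- **FINE BELOW COARSE**: for `x, y ∈ T^{(l)}`, `l < K`, `|x − y| ≤ L·|x₁ − y₁| + (L − 1)` with `x₁ = blockOf x`, `y₁ = blockOf y` (lattice units of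
`T^{(l)}` and `T^{(l+1)}`; two points of blocks with labels `D` apart are at most `L·D + L − 1` apart). [cite: Balaban1982Higgs1, (1.20) p.607] -/
theorem tdist_le_mul_tdist_blockOf_add {l : ℕ} (hl : l < P.K) (x y : HiggsLattice.Site P l) :
    HiggsLattice.Site.tdist x y ≤ P.L * HiggsLattice.Site.tdist (HiggsLattice.blockOf x) (HiggsLattice.blockOf y) + (P.L - 1) := by
  unfold HiggsLattice.Site.tdist
  refine Finset.sup_le fun μ _ => ?_
  have h := coord_fine_le (sitesPerDir_eq_L_mul_succ hl μ) P.hL (x μ) (y μ) ((HiggsLattice.blockOf x) μ) ((HiggsLattice.blockOf y) μ)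
    (val_blockOf_all x μ) (val_blockOf_all y μ)
  refine h.trans (Nat.add_le_add_right (Nat.mul_le_mul_left _ ?_) _)
  exact Finset.le_sup (f := fun ν : Fin P.d => min ((HiggsLattice.blockOf x) ν - (HiggsLattice.blockOf y) ν).val
    ((HiggsLattice.blockOf y) ν - (HiggsLattice.blockOf x) ν).val) (Finset.mem_univ μ)

/-- Real form: `|x − y| ≤ L·|x₁ − y₁| + L − 1`. [cite: Balaban1982Higgs1, (1.20) p.607] -/
theorem tdist_le_mul_tdist_blockOf_add_real {l : ℕ} (hl : l < P.K) (x y : HiggsLattice.Site P l) :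
    (HiggsLattice.Site.tdist x y : ℝ) ≤
      (P.L : ℝ) * (HiggsLattice.Site.tdist (HiggsLattice.blockOf x) (HiggsLattice.blockOf y) : ℝ) + ((P.L : ℝ) - 1) := by
  have h := tdist_le_mul_tdist_blockOf_add hl x y
  have hL : 1 ≤ P.L := P.hL
  have hcast : ((P.L * HiggsLattice.Site.tdist (HiggsLattice.blockOf x) (HiggsLattice.blockOf y) + (P.L - 1) : ℕ) : ℝ)
      = (P.L : ℝ) * (HiggsLattice.Site.tdist (HiggsLattice.blockOf x) (HiggsLattice.blockOf y) : ℝ) + ((P.L : ℝ) - 1) := by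
    push_cast [Nat.cast_sub hL]; ring
  rw [← hcast]
  exact_mod_cast h

/-! ## §3 The collars of (2.8) at site level -/

section Collars

variable {W : Finset (HiggsLattice.Site P k)} {bad : Set (HiggsLattice.Site P k)} {r : ℝ}

/-- **One collar**: `x ∈ Λ_{i+1}^{(·)}`, `|x − y| ≤ n` with `n ≤ r` ⇒ `y ∈ Λ_i^{(·)}` ((2.8): a point of `Λ_{i+1}` and a point outside `Λ_i` are `> r`
apart, `sep_regionRel`). [cite: Balaban1982Higgs2, (2.8) p.558] -/
theorem mem_regionRel_of_tdist_le (hr : 0 ≤ r) {n : ℕ} (hn : (n : ℝ) ≤ r) {i : ℕ} {x y : HiggsLattice.Site P k}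
    (hx : x ∈ regionRel W bad r (i + 1)) (hxy : HiggsLattice.Site.tdist x y ≤ n) : y ∈ regionRel W bad r i := by
  by_contra hy
  have h1 := sep_regionRel hr (Nat.lt_succ_self i) hx hy
  have h2 : (HiggsLattice.Site.tdist x y : ℝ) ≤ n := by exact_mod_cast hxy
  linarith

/-- **`m + 1` collars**: `x ∈ Λ_{i+m+1}`, `|x − y| ≤ (m + 1)·n` with `n ≤ r` ⇒ `y ∈ Λ_i` (induction: split the geodesic at distance `n`, §1; the
intermediate point lies in `Λ_{i+m}` by one collar). [cite: Balaban1982Higgs2, (2.8) p.558] -/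
theorem mem_regionRel_of_tdist_le_mul (hr : 0 ≤ r) {n : ℕ} (hn : (n : ℝ) ≤ r) :
    ∀ (m : ℕ) {i : ℕ} {x y : HiggsLattice.Site P k}, x ∈ regionRel W bad r (i + m + 1) →
      HiggsLattice.Site.tdist x y ≤ (m + 1) * n → y ∈ regionRel W bad r i
  | 0, i, x, y, hx, hxy => mem_regionRel_of_tdist_le hr hn hx (by simpa using hxy)
  | m + 1, i, x, y, hx, hxy => by
      obtain ⟨z, hxz, hzy⟩ := exists_tdist_split x y n
      have hz : z ∈ regionRel W bad r (i + m + 1) :=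
        mem_regionRel_of_tdist_le hr hn (i := i + m + 1) (by simpa [Nat.add_assoc] using hx) hxz
      refine mem_regionRel_of_tdist_le_mul hr hn m hz ?_
      have : HiggsLattice.Site.tdist x y - n ≤ (m + 1) * n := by
        have h' : (m + 1 + 1) * n = (m + 1) * n + n := by ring
        omega
      exact hzy.trans this

/-- **Two collars and the *"additional thickness r(ε)"***: `x ∈ Λ_{i+2}`, `|x − y| ≤ 3n` with `n < r` ⇒ `y ∈ near (Λ_i) r` — some point of `Λ_i`
lies within `< r` of `y` (split at `2n`: the intermediate point is in `Λ_i`, and `n < r` further is `y`).  At `i = 0` this is `Λ₂ ⊂ Λ₋₁` with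
room `3n`. [cite: Balaban1982Higgs2, (2.8)–(2.9) p.558] -/
theorem mem_near_regionRel_of_tdist_le (hr : 0 ≤ r) {n : ℕ} (hn : (n : ℝ) < r) {i : ℕ} {x y : HiggsLattice.Site P k}
    (hx : x ∈ regionRel W bad r (i + 2)) (hxy : HiggsLattice.Site.tdist x y ≤ 3 * n) : y ∈ near (regionRel W bad r i) r := by
  obtain ⟨z, hxz, hzy⟩ := exists_tdist_split x y (2 * n)
  have hz : z ∈ regionRel W bad r i :=
    mem_regionRel_of_tdist_le_mul hr hn.le 1 (i := i) (by simpa using hx) (by simpa [two_mul, Nat.add_mul] using hxz)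
  rw [mem_near]
  refine ⟨z, hz, ?_⟩
  have h1 : HiggsLattice.Site.tdist z y ≤ n := by omega
  calc (HiggsLattice.Site.tdist z y : ℝ) ≤ n := by exact_mod_cast h1
    _ < r := hn

end Collars

section TowerCollars

variable {bad : (j : ℕ) → Set (HiggsLattice.Site P j)} {rr : ℕ → ℝ}

/-- The collars for the CONSTRUCTED tower `Λ_i^{(l)} = towerRegion bad r l i` (= `regionRel` in the step's window): `x ∈ Λ_{i+m+1}^{(l)}`,
`|x − y| ≤ (m + 1)·n`, `n ≤ r(Lˡε)` ⇒ `y ∈ Λ_i^{(l)}`. [cite: Balaban1982Higgs2, (2.8) p.558, (2.43) p.566] -/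
theorem mem_towerRegion_of_tdist_le_mul {l : ℕ} (hr : 0 ≤ rr l) {n : ℕ} (hn : (n : ℝ) ≤ rr l) (m : ℕ) {i : ℕ}
    {x y : HiggsLattice.Site P l} (hx : x ∈ towerRegion bad rr l (i + m + 1)) (hxy : HiggsLattice.Site.tdist x y ≤ (m + 1) * n) :
    y ∈ towerRegion bad rr l i := by
  rw [towerRegion_eq] at hx ⊢
  exact mem_regionRel_of_tdist_le_mul hr hn m hx hxy

/-- `x ∈ Λ_{i+2}^{(l)}`, `|x − y| ≤ 3n`, `n < r(Lˡε)` ⇒ `y ∈ near (Λ_i^{(l)}) r(Lˡε)` (at `i = 0`: the point part of `Λ₋₁^{(l)}`).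
[cite: Balaban1982Higgs2, (2.8)–(2.9) p.558, (2.43) p.566] -/
theorem mem_near_towerRegion_of_tdist_le {l : ℕ} (hr : 0 ≤ rr l) {n : ℕ} (hn : (n : ℝ) < rr l) {i : ℕ}
    {x y : HiggsLattice.Site P l} (hx : x ∈ towerRegion bad rr l (i + 2)) (hxy : HiggsLattice.Site.tdist x y ≤ 3 * n) :
    y ∈ near (towerRegion bad rr l i) (rr l) := by
  rw [towerRegion_eq] at hx ⊢
  exact mem_near_regionRel_of_tdist_le hr hn hx hxy

end TowerCollars

/-! ## §4 The block-label form: the `nbhd` hypothesis of Lemma 2.3 on the carrier -/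

/-- `Λ ⊆ Λ̃ ⇒ Λ′ ⊆ Λ̃′`. [cite: Balaban1982Higgs2, (3.22) p.588] -/
theorem prime_mono {l : ℕ} {Λ Λ' : Finset (HiggsLattice.Site P l)} (h : Λ ⊆ Λ') : prime Λ ⊆ prime Λ' := fun y hy =>
  (mem_prime Λ' y).mpr fun x hx => h ((mem_prime Λ y).mp hy x hx)

section BlockLabel

variable {l : ℕ} {W : Finset (HiggsLattice.Site P l)} {bad : Set (HiggsLattice.Site P l)} {r : ℝ}

/-- **THE `nbhd` SHAPE, general radius**: if `x₁ = blockOf x ∈ (Λ_{i+2})′`, `y′ ∈ T^{(l+1)}` with `|x₁ − y′| ≤ ρ + 1`, and the room condition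
`L(ρ + 2) − 1 ≤ 3n` holds for some `n < r`, then `y′ ∈ (near Λ_i r)′`: every point `y` of the block `B(y′)` is within `L(ρ + 1) + L − 1 ≤ 3n` of
`x ∈ Λ_{i+2}` (§2), hence in `near Λ_i r` (§3). [cite: Balaban1982Higgs2, (2.8) p.558, Lemma 2.3 p.571] -/
theorem mem_prime_near_of_tdist_blockOf_le (hl : l < P.K) (hr : 0 ≤ r) {n : ℕ} (hn : (n : ℝ) < r) {ρ : ℝ}
    (hρ : (P.L : ℝ) * (ρ + 2) - 1 ≤ 3 * (n : ℝ)) {i : ℕ} {x : HiggsLattice.Site P l}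
    (hx : HiggsLattice.blockOf x ∈ prime (regionRel W bad r (i + 2))) {y' : HiggsLattice.Site P (l + 1)}
    (hd : (HiggsLattice.Site.tdist (HiggsLattice.blockOf x) y' : ℝ) ≤ ρ + 1) : y' ∈ prime (near (regionRel W bad r i) r) := by
  rw [mem_prime]
  intro y hy
  have hxΛ : x ∈ regionRel W bad r (i + 2) := (mem_prime _ _).mp hx x rfl
  have h1 := tdist_le_mul_tdist_blockOf_add_real hl x y
  rw [hy] at h1
  have hL0 : (0 : ℝ) ≤ (P.L : ℝ) := Nat.cast_nonneg _
  have h2 : (HiggsLattice.Site.tdist x y : ℝ) ≤ 3 * (n : ℝ) := by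
    have := mul_le_mul_of_nonneg_left hd hL0
    linarith
  have h3 : HiggsLattice.Site.tdist x y ≤ 3 * n := by exact_mod_cast h2
  exact mem_near_regionRel_of_tdist_le hr hn hxΛ h3

end BlockLabel

section TowerBlockLabel

variable {bad : (j : ℕ) → Set (HiggsLattice.Site P j)} {rr : ℕ → ℝ}

/-- **THE `nbhd` HYPOTHESIS OF LEMMA 2.3 FOR THE CONSTRUCTED REGIONS, general radius**: at level `k = l + 1 ≤ K`, with
`L2 := (Λ₂^{(l)})′` and `L1 := (near Λ₀^{(l)} r(Lˡε))′ ⊆ Λ₋₁^{(l)′}`: for every fine point `x` with `x_k ∈ L2` and every block label `y′` with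
`|x_k − y′| ≤ ρ + 1`, `y′ ∈ L1` — provided `L(ρ + 2) − 1 ≤ 3n` for some `n < r(Lˡε)` (verbatim the binder shape of
`B2Lemma23HiggsLattice.lemma23_higgsLattice`'s `nbhd` / `RMultiMK.nbhd` at that level). [cite: Balaban1982Higgs2, Lemma 2.3 p.571, (2.8) p.558, (2.55) p.570] -/
theorem nbhd_towerRegion {l : ℕ} (hl : l < P.K) (hr : 0 ≤ rr l) {n : ℕ} (hn : (n : ℝ) < rr l) {ρ : ℝ}
    (hρ : (P.L : ℝ) * (ρ + 2) - 1 ≤ 3 * (n : ℝ)) (x : HiggsLattice.Site P 0) (y' : HiggsLattice.Site P (l + 1))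
    (hx : blockIter (l + 1) x ∈ prime (towerRegion bad rr l 2))
    (hd : (HiggsLattice.Site.tdist (blockIter (l + 1) x) y' : ℝ) ≤ ρ + 1) :
    y' ∈ prime (near (towerRegion bad rr l 0) (rr l)) := by
  rw [towerRegion_eq] at hx ⊢
  rw [blockIter_succ_eq] at hx hd
  exact mem_prime_near_of_tdist_blockOf_le hl hr hn hρ (i := 0) hx hd

/-- `(Λ₂^{(l)})′ ⊆ (near Λ₀^{(l)} r)′` (`Λ₂ ⊆ Λ₀ ⊆` its `r`-neighbourhood, `r > 0`) — the `L2_sub` shape. [cite: Balaban1982Higgs2, (2.8) p.558] -/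
theorem prime_towerRegion_two_subset {l : ℕ} (hr : 0 < rr l) :
    prime (towerRegion bad rr l 2) ⊆ prime (near (towerRegion bad rr l 0) (rr l)) :=
  prime_mono ((towerRegion_antitone hr.le (by norm_num : 0 ≤ 2)).trans (subset_near hr))

/-- `(Λ₅^{(l)})′ ⊆ (Λ₂^{(l)})′` for the tower's `Λ₅^{(l)} = (towerOf bad r hr K).lam l`, `l < K` — the `lam_sub` shape (print: `Λ₅ ⊂ Λ₂`).
[cite: Balaban1982Higgs2, (2.8) p.558, (3.22) p.588] -/
theorem prime_lam_subset (hr : ∀ j, 0 ≤ rr j) {K l : ℕ} (hl : l < K) :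
    prime ((towerOf bad rr hr K).lam l) ⊆ prime (towerRegion bad rr l 2) := by
  rw [towerOf_lam_of_lt hl]
  exact prime_mono (towerRegion_antitone (hr l) (by norm_num : 2 ≤ 5))

end TowerBlockLabel

/-! ## §5 The ruled radius (c) of GAPS.md G-B2-12: `ρ_k = 3r(L^{k−1}ε)/L − 2M − 2`

The step-`k` cut-off radius of the cell's reading (c) (G-B2-12 OWNER ADJUDICATION, r02 g11 2026-08-22T04:40Z on r14 g13's reader note) is
`ρ_k = 3r(L^{k−1}ε)/L − 2M − 2` in lattice units of `T^{(k)}`, `r(s) = R(1 + log s⁻¹)^r` ((2.7), b2b's `B2.rFn`), `M` the large-block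
factor (I p. 607) — a READING replacing the printed (2.44) radius `r(Lᵏε) − 2M` (which does not fit inside the three (2.8)-collars for
`L ≥ 4`).  It is written out explicitly below (`3 * B2.rFn R r (P.mesh l) / P.L - 2 * P.M - 2` at `k = l + 1`); the minimizer-family file names it. -/

/-- **The room condition holds for the radius (c)**: with `n = ⌈r(Lˡε)⌉ − 1` (so `n < r(Lˡε)` when `r(Lˡε) > 0`, and `n ≥ r(Lˡε) − 1`),
`L(ρ_{l+1} + 2) − 1 = 3r(Lˡε) − 2ML − 1 ≤ 3n` since `ML ≥ 1`. [cite: Balaban1982Higgs2, (2.8) p.558, (2.44) p.566] -/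
theorem radC_geom (R r : ℝ) (P : HiggsLattice.Params) (l : ℕ) (hpos : 0 < B2.rFn R r (P.mesh l)) :
    ((⌈B2.rFn R r (P.mesh l)⌉₊ - 1 : ℕ) : ℝ) < B2.rFn R r (P.mesh l) ∧
      (P.L : ℝ) * ((3 * B2.rFn R r (P.mesh l) / (P.L : ℝ) - 2 * (P.M : ℝ) - 2) + 2) - 1
        ≤ 3 * (((⌈B2.rFn R r (P.mesh l)⌉₊ - 1 : ℕ) : ℝ)) := by
  set s : ℝ := B2.rFn R r (P.mesh l) with hs
  have hceil1 : 1 ≤ ⌈s⌉₊ := Nat.one_le_iff_ne_zero.mpr (by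
    intro h0
    have := Nat.ceil_eq_zero.mp h0
    linarith)
  have hcast : (((⌈s⌉₊ - 1 : ℕ) : ℝ)) = (⌈s⌉₊ : ℝ) - 1 := by rw [Nat.cast_sub hceil1, Nat.cast_one]
  have hlt : (⌈s⌉₊ : ℝ) < s + 1 := Nat.ceil_lt_add_one hpos.le
  have hge : s ≤ (⌈s⌉₊ : ℝ) := Nat.le_ceil s
  have hL1 : (1 : ℝ) ≤ (P.L : ℝ) := by exact_mod_cast P.hL
  have hM1 : (1 : ℝ) ≤ (P.M : ℝ) := by exact_mod_cast P.hM
  have hL0 : (0 : ℝ) < (P.L : ℝ) := by linarith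
  refine ⟨by rw [hcast]; linarith, ?_⟩
  rw [hcast]
  have hexp : (P.L : ℝ) * (3 * s / (P.L : ℝ) - 2 * (P.M : ℝ) - 2 + 2) - 1 = 3 * s - 2 * ((P.M : ℝ) * (P.L : ℝ)) - 1 := by
    field_simp
    ring
  rw [hexp]
  have hML : (1 : ℝ) ≤ (P.M : ℝ) * (P.L : ℝ) := by nlinarith
  linarith

/-- **`nbhd` FOR THE CONSTRUCTED REGIONS AT THE RULED RADIUS (c).**  For every torus of the (Higgs)₂,₃ family, every large-field datum `bad`,
every level `k = l + 1 ≤ K` whose step-`k` regions ((2.7)–(2.8) on `T₁^{(k−1)}`) have radius `r(Lˡε) > 0`: if the `k`-block label of the fine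
point `x` lies in `(Λ₂^{(l)})′` and `|x_k − y′| ≤ ρ_k + 1`, `ρ_k = 3r(Lˡε)/L − 2M − 2`, then `y′ ∈ (near Λ₀^{(l)} r(Lˡε))′ ⊆ Λ₋₁^{(l)′}` — so
`supp ζ^{(k)}(x, ·)` (radius `ρ_k`) and its one-step translates stay inside the (2.55) window, as Lemma 2.3's proof p. 571 requires: the FIELD
`nbhd` of `RMultiMK` / the HYPOTHESIS `nbhd` of `lemma23_higgsLattice` at level `k`, DISCHARGED for the constructed regions.
[cite: Balaban1982Higgs2, Lemma 2.3 p.571, (2.44) p.566, (2.55) p.570, (2.8) p.558] -/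
theorem nbhd_radC {bad : (j : ℕ) → Set (HiggsLattice.Site P j)} {R r : ℝ} {rr : ℕ → ℝ} {l : ℕ} (hl : l + 1 ≤ P.K)
    (hrr : rr l = B2.rFn R r (P.mesh l)) (hpos : 0 < B2.rFn R r (P.mesh l))
    (x : HiggsLattice.Site P 0) (y' : HiggsLattice.Site P (l + 1)) (hx : blockIter (l + 1) x ∈ prime (towerRegion bad rr l 2))
    (hd : (HiggsLattice.Site.tdist (blockIter (l + 1) x) y' : ℝ) ≤ (3 * B2.rFn R r (P.mesh l) / (P.L : ℝ) - 2 * (P.M : ℝ) - 2) + 1) :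
    y' ∈ prime (near (towerRegion bad rr l 0) (rr l)) := by
  obtain ⟨hn, hρ⟩ := radC_geom R r P l hpos
  have hn' : ((⌈B2.rFn R r (P.mesh l)⌉₊ - 1 : ℕ) : ℝ) < rr l := by rw [hrr]; exact hn
  have hpos' : 0 ≤ rr l := by rw [hrr]; exact hpos.le
  exact nbhd_towerRegion (by omega) hpos' hn' hρ x y' hx hd

end Literature.MathematicalPhysics.QuantumFieldTheory.Balaban1983to89.B2Eq28RegionsCollars

end
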